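import Summits.AtomisticToContinuum.FouriersLaw.Theorems.BondHeatUncertaintyExtensiveSnapshotIrreversibilityEnergyWindowKernelTestClassesA
import Literature.Analysis.FunctionSpaces.SmoothParametricIntegralDominated
import Literature.Analysis.FunctionSpaces.IteratedFDerivParametricIntegral

/-!
# Crux `ExtensiveSnapshotIrreversibility` (stmt-AtomisticToContinuum-9121): the far-side Duhamel split beneath S3, part A — the pieces, and (R2) proved

Cell decomp-a2c, lens «grading / quantitative ladder», generation 82, part A of the node
«HessianSplit» (the glue and the junctions are in `…EnergyWindowHessianSplit`, which imports this
file; the mathematics and the leaf table are in that file's docstring).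

CONTENTS.  §1 the three pieces of the far-side split of the Duhamel formula beneath the kernel leaf
S3 `KernelTemperatureLipschitz`: (R2) `EqualTemperatureOrbitSmooth` (`P^0_r h ∈ C²` for
`h ∈ C_c^∞`, `r > 0`), (G2) `EqualTemperatureBathHessian` (fixed-time second-order smoothing of the
equal-temperature semigroup at the bath momenta, `r ∈ [½, 1]`, NO rate), (G2*)
`PerturbedKernelHessianIBP` (fixed-time double integration by parts against the two-temperature
kernel, `s ∈ [½, 1]`, NO rate); §2 measurability of `∂²_{p_b} G` for `G ∈ C²`; §3 ★ (R2) PROVED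
(`equalTemperatureOrbitSmooth`): `u_r(w) = ∫ p(r, w, y) h(y) dy` with the jointly smooth transition
density of the tree (`IsTransitionDensity`, `isTransitionDensity_exists` — CEHR Prop. 3.2 from
Hörmander's theorem, PROVED in the tree) is `C^∞` by differentiation under the integral sign to all
orders (`Literature.Analysis.FunctionSpaces.contDiffOn_integral_of_dominated`, local domination:
the partial jets `(y, w) ↦ D^m_w (p(r, w, y) h(y))` are jointly continuous
(`contDiff_iteratedFDeriv_section_right`), hence bounded on `tsupport h × B̄(w₀, 1)`, and vanish
for `y ∉ tsupport h`).

References: N. Cuneo, J.-P. Eckmann, M. Hairer, L. Rey-Bellet, EJP 23 (2018) no. 55, §3 (3.2),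
(3.4), Prop 3.2; M. Hairer, J. C. Mattingly, EJP 16 (2011) 658–738, Thm 6.7; D. Nualart, The
Malliavin Calculus and Related Topics (2006), Prop 2.1.4, §2.3; L. Hörmander, The Analysis of
Linear Partial Differential Operators I, Thm 1.1.9 (differentiation under the integral sign).
-/

noncomputable section

namespace Summit.AtomisticToContinuum.FouriersLaw.Theorems.ExtensiveSnapshotIrreversibility.EnergyWindow

open MeasureTheory Filter Topology Real Set Metric
open scoped ENNReal NNReal ContDiff
open Literature.MathematicalPhysics.KineticTheory.HeatConduction
open Literature.Probability.Process
open Literature.Analysis.FunctionSpaces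

/-! ## 1. The three new pieces -/

/-- **(R2) `EqualTemperatureOrbitSmooth`** (NEW · WEAKER than the summit · PROVED in §3 below): for
positive parameters, `T > 0`, `N ≥ 1`, every smooth compactly supported `h` and every `r > 0`, the
equal-temperature orbit `u_r = P^0_r h` (`eqKernelFun`) is `C²` — differentiation under
`∫_{supp h} h(y) p(r, ·, y) dy`, `p` the jointly smooth transition density of the tree
(`IsTransitionDensity`).  No `h`-free constant is asserted.
(after CuneoEckmannHairerReyBellet2018, Prop 3.2) [route leaf · named hypothesis of this cell, NOT filed as a literature fact] -/
def EqualTemperatureOrbitSmooth : Prop :=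
  ∀ ω₂ lam β γ : ℝ, 0 < ω₂ → 0 < lam → 0 < β → 0 < γ →
    ∀ T : ℝ, 0 < T → ∀ N : ℕ, 0 < N →
      ∀ (h : PhaseSpace N → ℝ), ContDiff ℝ ∞ h → HasCompactSupport h →
        ∀ r : ℝ, 0 < r → ContDiff ℝ 2 (eqKernelFun ω₂ lam β γ T N h r)

/-- **(G2) `EqualTemperatureBathHessian`** (NEW · WEAKER than the summit · ATTACKABLE-L): the
fixed-time second-order smoothing bound of the equal-temperature semigroup in a bath momentum.  For
positive parameters, `T > 0`, `N ≥ 2` and rates `0 < θ < θ' < 1/T` there is `C` with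
`|∂_{p_b} ∂_{p_b} P^0_r h (w)| ≤ C e^{θ'H(w)}` for all `r ∈ [½, 1]`, all smooth compactly supported
`|h| ≤ e^{θH}`, both bath sites `b`, all `w` — NO short-time rate (second-order Bismut–Malliavin
formula at time `r ≥ ½`: Malliavin-matrix inverse moments with Lyapunov-weighted dependence on the
start, variation moments, Hölder with CEHR (3.4)).
(after HairerMattingly2011spde, Thm 6.7) (after KusuokaStroock1985, Thm 2.1)
(after CuneoEckmannHairerReyBellet2018, §3 eq. (3.4)) [route leaf · named hypothesis of this cell, NOT filed as a literature fact] -/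
def EqualTemperatureBathHessian : Prop :=
  ∀ ω₂ lam β γ : ℝ, 0 < ω₂ → 0 < lam → 0 < β → 0 < γ →
    ∀ T : ℝ, 0 < T → ∀ (N : ℕ) (hN : 2 ≤ N), ∀ θ θ' : ℝ, 0 < θ → θ < θ' → θ' < 1 / T →
      ∃ C : ℝ, ∀ r : ℝ, 1 / 2 ≤ r → r ≤ 1 →
        ∀ (h : PhaseSpace N → ℝ), ContDiff ℝ ∞ h → HasCompactSupport h →
          (∀ y, |h y| ≤ Real.exp (θ * (pinnedChain ω₂ lam β γ).hamiltonian N y)) →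
          ∀ b : Fin N, (b = leftBath N hN ∨ b = rightBath N hN) → ∀ w : PhaseSpace N,
            |partialP b (partialP b (eqKernelFun ω₂ lam β γ T N h r)) w| ≤
              C * Real.exp (θ' * (pinnedChain ω₂ lam β γ).hamiltonian N w)

/-- **(G2*) `PerturbedKernelHessianIBP`** (NEW · WEAKER than the summit · ATTACKABLE-L): the
fixed-time double integration by parts against the two-temperature kernel, uniform in the
temperature perturbation.  For positive parameters, `T > 0`, `N ≥ 2` and rates
`0 < θ₁ < θ₂ < 1/T` there are `δ₀ > 0` and `C` with
`|∫ ∂_{p_b} ∂_{p_b} G dP^δ_s(z,·)| ≤ C M e^{θ₂H(z)}` for `|δ| < δ₀`, `s ∈ [½, 1]`, both bath sites,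
all `M ≥ 0`, all `G ∈ C²` with `|G| ≤ M e^{θ₁H}`, all `z` — NO short-time rate (second-order
Skorokhod weight of the Malliavin matrix at time `s ≥ ½`, i.e. the Lyapunov-weighted `W^{2,1}`
bound of the smooth density in the arrival bath momentum; truncation `G χ_R`, the cross term removed
by one more integration by parts).
(after Nualart2006, Prop 2.1.4) (after HairerMattingly2011spde, Thm 6.7)
(after CuneoEckmannHairerReyBellet2018, Prop 3.2) [route leaf · named hypothesis of this cell, NOT filed as a literature fact] -/
def PerturbedKernelHessianIBP : Prop :=
  ∀ ω₂ lam β γ : ℝ, 0 < ω₂ → 0 < lam → 0 < β → 0 < γ →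
    ∀ T : ℝ, 0 < T → ∀ (N : ℕ) (hN : 2 ≤ N), ∀ θ₁ θ₂ : ℝ, 0 < θ₁ → θ₁ < θ₂ → θ₂ < 1 / T →
      ∃ δ₀ C : ℝ, 0 < δ₀ ∧ ∀ δ : ℝ, |δ| < δ₀ →
        ∀ s : ℝ, 1 / 2 ≤ s → s ≤ 1 → ∀ b : Fin N, (b = leftBath N hN ∨ b = rightBath N hN) →
          ∀ M : ℝ, 0 ≤ M → ∀ G : PhaseSpace N → ℝ, ContDiff ℝ 2 G →
            (∀ w, |G w| ≤ M * Real.exp (θ₁ * (pinnedChain ω₂ lam β γ).hamiltonian N w)) →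
            ∀ z : PhaseSpace N,
              |∫ w, partialP b (partialP b G) w ∂(pertKernel ω₂ lam β γ T δ N s z)| ≤
                C * M * Real.exp (θ₂ * (pinnedChain ω₂ lam β γ).hamiltonian N z)

/-! ## 2. `∂_{p_b} ∂_{p_b} G` is measurable for `G ∈ C²` -/

section Calculus

variable {N : ℕ}

/-- For `G ∈ C²`, `∂_{p_b} G = DG · (0, e_b)` is `C¹`. [folklore] -/
theorem contDiff_one_partialP_of_contDiff_two (b : Fin N) {G : PhaseSpace N → ℝ}
    (hG : ContDiff ℝ 2 G) : ContDiff ℝ 1 (partialP b G) := by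
  rw [partialP_eq_fderiv (hG.differentiable (by norm_num)) b]
  exact (hG.fderiv_right (m := 1) (by norm_num)).clm_apply contDiff_const

/-- For `G ∈ C²`, `∂_{p_b} ∂_{p_b} G` is continuous, hence measurable. [folklore] -/
theorem measurable_partialP_partialP_of_contDiff_two (b : Fin N) {G : PhaseSpace N → ℝ}
    (hG : ContDiff ℝ 2 G) : Measurable (partialP b (partialP b G)) :=
  (continuous_partialP_of_contDiff b (contDiff_one_partialP_of_contDiff_two b hG)).measurable

end Calculus
/-! ## 3. ★ (R2) is a theorem: `P^0_r h ∈ C^∞` for `h ∈ C_c^∞`, `r > 0` -/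

/-- **`u_r = P⁰_r h` is smooth for `h ∈ C_c^∞` and `r > 0`**: write `u_r(w) = ∫ p(r, w, y) h(y) dy`
with the jointly smooth transition density (CEHR Prop. 3.2, in the tree) and differentiate under
the integral sign to all orders (local domination: the jets of `w ↦ p(r, w, y) h(y)` are jointly
continuous in `(y, w)`, hence bounded on `tsupport h × B̄(w₀, 1)`, and vanish for
`y ∉ tsupport h`). [folklore] -/
theorem contDiff_eqKernelFun {ω₂ lam β γ : ℝ} (hω : 0 < ω₂) (hl : 0 < lam) (hβ : 0 < β)
    (hγ : 0 < γ) {T : ℝ} (hT : 0 < T) {N : ℕ} (hN : 0 < N) {h : PhaseSpace N → ℝ}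
    (hh : ContDiff ℝ ∞ h) (hhc : HasCompactSupport h) {r : ℝ} (hr : 0 < r) :
    ContDiff ℝ ∞ (eqKernelFun ω₂ lam β γ T N h r) := by
  obtain ⟨p, hp⟩ := isTransitionDensity_exists hω hl.le hβ.le hγ hN hT hT.le
  -- the jointly smooth integrand `G (y, w) = p(r, w, y) h(y)`
  have hG : ContDiff ℝ ∞ fun v : PhaseSpace N × PhaseSpace N => p r v.2 v.1 * h v.1 := by
    have h1 : ContDiff ℝ ∞ fun v : PhaseSpace N × PhaseSpace N => p r v.2 v.1 :=
      hp.1.comp_contDiff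
        (f := fun v : PhaseSpace N × PhaseSpace N =>
          ((r, v.2, v.1) : ℝ × PhaseSpace N × PhaseSpace N))
        (contDiff_const.prodMk (contDiff_snd.prodMk contDiff_fst)) fun v => ⟨hr, Set.mem_univ _⟩
    exact h1.mul (hh.comp contDiff_fst)
  have hJ : ∀ m : ℕ, Continuous fun q : PhaseSpace N × PhaseSpace N =>
      iteratedFDeriv ℝ m (fun w : PhaseSpace N => p r w q.1 * h q.1) q.2 := fun m =>
    (contDiff_iteratedFDeriv_section_right hG m).continuous
  -- `u_r` as a Lebesgue integral against the density
  have hfun : eqKernelFun ω₂ lam β γ T N h r = fun w => ∫ y, p r w y * h y := by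
    funext w
    unfold eqKernelFun
    rw [hp.kernel_eq hr w, integral_withDensity_ofReal_phaseSpace
      (hp.contDiff_right hr w).continuous.measurable (hp.2.1 r hr w)]
  rw [hfun]
  refine contDiffOn_univ.1 (contDiffOn_integral_of_dominated
    (μ := (volume : Measure (PhaseSpace N))) (f := fun w y => p r w y * h y) isOpen_univ
    (Eventually.of_forall fun y => (hG.comp (contDiff_prodMk_right y)).contDiffOn)
    (fun m w _ => ((hJ m).comp (continuous_id.prodMk continuous_const)).aestronglyMeasurable)
    fun m w₀ _ => ?_)
  obtain ⟨C₀, hC₀⟩ := (hhc.isCompact.prod (isCompact_closedBall w₀ 1)).exists_bound_of_continuousOn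
    (hJ m).continuousOn
  have hKm : MeasurableSet (tsupport h) := (isClosed_tsupport h).measurableSet
  refine ⟨1, one_pos, (tsupport h).indicator fun _ => max C₀ 0, ?_,
    Eventually.of_forall fun y w hw => ?_⟩
  · rw [integrable_indicator_iff hKm]
    exact integrableOn_const (hhc.isCompact.measure_lt_top).ne
  · by_cases hy : y ∈ tsupport h
    · rw [Set.indicator_of_mem hy]
      exact (hC₀ (y, w) ⟨hy, ball_subset_closedBall hw⟩).trans (le_max_left _ _)
    · have h0 : (fun w : PhaseSpace N => p r w y * h y) = fun _ => 0 := by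
        funext w
        rw [image_eq_zero_of_notMem_tsupport hy, mul_zero]
      rw [Set.indicator_of_notMem hy, h0, iteratedFDeriv_fun_zero, Pi.zero_apply, norm_zero]

/-- ★ **(R2) `EqualTemperatureOrbitSmooth` holds** (from `contDiff_eqKernelFun`). [folklore] -/
theorem equalTemperatureOrbitSmooth : EqualTemperatureOrbitSmooth :=
  fun _ω₂ _lam _β _γ hω hl hβ hγ _T hT _N hN _h hh hhc _r hr =>
    (contDiff_eqKernelFun hω hl hβ hγ hT hN hh hhc hr).of_le (WithTop.coe_le_coe.2 le_top)

end Summit.AtomisticToContinuum.FouriersLaw.Theorems.ExtensiveSnapshotIrreversibility.EnergyWindow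

end
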